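import Summits.ValiantsHypothesis.ValiantsHypothesis.Theorems.BarrierLeverChowHitsPartitionMinorsRHybridDesign
import Summits.ValiantsHypothesis.ValiantsHypothesis.Theorems.BarrierLeverChowHitsPartitionMinorsRMatchingDesign

/-!
# Route BarrierLever — item `ChowHitsPartitionMinorsR` (stmt-ValiantsHypothesis-21882):
# THEOREM H — the arrows, the lower-set budget, and the residual node «both defect masses large»

Helper file (`--supports stmt-ValiantsHypothesis-21882`; cell valiant-natproofs, rung V4, 𝒟-side support item of route
BarrierLever; prover seat val-np-p5 gen 32; seat memo MEMO-21882-valnp5-g32.md §6). Closes NO item. Companion of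
`…RHybridDesign` (THEOREM H `ChowHybrid.chowHits_of_hybrid`).

* `colDefectMass u w = Σ_{j : w j ∉ range u} |w j|` (= `‖C∖R‖`), `rowDefectMass u w = colDefectMass w u` (= `‖R∖C‖`);
* `chowHits_of_hybrid_le` — hit by `M` affine forms for every `M ≥ h + ‖C∖R‖`; `chowHits_of_hybrid_swap_le` — for every
  `M ≥ h + ‖R∖C‖` (THEOREM H for `(w, u)` and the flip `ChowFacePrivate.chow_hit_swap_fin`);
* `exists_chow_of_small_defect` — **inside the lower-set budget**: if `h + ‖C∖R‖ + 2h ≤ h·h` or `h + ‖R∖C‖ + 2h ≤ h·h`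
  then `∃ m, m + 2h ≤ h·h` forms hitting the pair;
* node text `ChowNoStar.Stmt.stub_thickLowerSetsChowRLargeDefect` := the NoMD lower-set node (p729761) VERBATIM with the two
  further ARITHMETIC hypotheses `h·h < h + ‖C∖R‖ + 2h` and `h·h < h + ‖R∖C‖ + 2h`; UNCONDITIONAL glue
  `stub_thickLowerSetsChowRNoMD_of_largeDefect`; composition `chowHitsPartitionMinorsR_of_thickLowerSetsLargeDefect` into the item.

WHAT THIS IS NOT: item 21882 is NOT proved — the large-defect node remains OPEN; nothing on crux 14610 or `VP ≠ VNP`.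
-/

set_option linter.dupNamespace false

open Finset MvPolynomial

noncomputable section

namespace Summit.ValiantsHypothesis.ValiantsHypothesis.Theorems.BarrierLever.ChowHybrid

variable {h r : ℕ}

/-- **Column defect mass** `‖C∖R‖ = Σ_{j : w j ∉ range u} |w j|`. -/
def colDefectMass (u w : Fin r → Finset (Fin h)) : ℕ := ∑ j : {j : Fin r // ¬ ∃ i, u i = w j}, (w j.1).card

/-- **THEOREM H at every larger budget**: hit by `M` affine forms for every `M ≥ h + ‖C∖R‖`. -/
theorem chowHits_of_hybrid_le {M : ℕ} (u w : Fin r → Finset (Fin h)) (hu : Function.Injective u)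
    (hw : Function.Injective w) (hlu : IsLowerSet (Set.range u)) (hlw : IsLowerSet (Set.range w))
    (hM : h + colDefectMass u w ≤ M) :
    ∃ ℓ : Fin M → MvPolynomial (Fin (h + h)) ℂ, (∀ k, (ℓ k).totalDegree ≤ 1) ∧
      (Matrix.of fun i j : Fin r => MvPolynomial.coeff (∑ a ∈ u i, Finsupp.single (Fin.castAdd h a) 1 +
          ∑ c ∈ w j, Finsupp.single (Fin.natAdd h c) 1) (∏ k, ℓ k)).det ≠ 0 :=
  ChowNoStar.chowHits_mono hM u w (chowHits_of_hybrid u w hu hw hlu hlw)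

/-- **THEOREM H, swapped**: hit by `M` affine forms for every `M ≥ h + ‖R∖C‖`. -/
theorem chowHits_of_hybrid_swap_le {M : ℕ} (u w : Fin r → Finset (Fin h)) (hu : Function.Injective u)
    (hw : Function.Injective w) (hlu : IsLowerSet (Set.range u)) (hlw : IsLowerSet (Set.range w))
    (hM : h + colDefectMass w u ≤ M) :
    ∃ ℓ : Fin M → MvPolynomial (Fin (h + h)) ℂ, (∀ k, (ℓ k).totalDegree ≤ 1) ∧
      (Matrix.of fun i j : Fin r => MvPolynomial.coeff (∑ a ∈ u i, Finsupp.single (Fin.castAdd h a) 1 +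
          ∑ c ∈ w j, Finsupp.single (Fin.natAdd h c) 1) (∏ k, ℓ k)).det ≠ 0 :=
  ChowFacePrivate.chow_hit_swap_fin u w (chowHits_of_hybrid_le w u hw hu hlw hlu hM)

/-- **Inside the lower-set budget**: a pair one of whose defect masses is `≤ h·h − 3h` is hit within `m + 2h ≤ h·h`. -/
theorem exists_chow_of_small_defect (u w : Fin r → Finset (Fin h)) (hu : Function.Injective u)
    (hw : Function.Injective w) (hlu : IsLowerSet (Set.range u)) (hlw : IsLowerSet (Set.range w))
    (hsmall : h + colDefectMass u w + 2 * h ≤ h * h ∨ h + colDefectMass w u + 2 * h ≤ h * h) :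
    ∃ m : ℕ, m + 2 * h ≤ h * h ∧ ∃ ℓ : Fin m → MvPolynomial (Fin (h + h)) ℂ,
      (∀ k, (ℓ k).totalDegree ≤ 1) ∧
      (Matrix.of fun i j : Fin r => MvPolynomial.coeff
        (∑ a ∈ u i, Finsupp.single (Fin.castAdd h a) 1 +
          ∑ c ∈ w j, Finsupp.single (Fin.natAdd h c) 1) (∏ k, ℓ k)).det ≠ 0 := by
  rcases hsmall with h1 | h2
  · exact ⟨h + colDefectMass u w, h1, chowHits_of_hybrid_le u w hu hw hlu hlw le_rfl⟩
  · exact ⟨h + colDefectMass w u, h2, chowHits_of_hybrid_swap_le u w hu hw hlu hlw le_rfl⟩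

end Summit.ValiantsHypothesis.ValiantsHypothesis.Theorems.BarrierLever.ChowHybrid

/-! ## The residual node «both defect masses exceed the budget» -/

namespace Summit.ValiantsHypothesis.ValiantsHypothesis.Theorems.BarrierLever.ChowNoStar

open Summit.ValiantsHypothesis.ValiantsHypothesis.Theorems.BarrierLever.ChowHybrid
  (colDefectMass exists_chow_of_small_defect)

variable {h r : ℕ}

/-- **NARROWED NODE (THEOREM H): THICK LOWER-SET PAIRS, not star / bi-star / starved / MD-within-budget, AND WITH BOTH DEFECT
MASSES BEYOND THE BUDGET** — `Stmt.stub_thickLowerSetsChowRNoMD` (p729761) VERBATIM with the further arithmetic hypotheses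
`h·h < h + ‖C∖R‖ + 2h` and `h·h < h + ‖R∖C‖ + 2h`. WEAKER, UNCONDITIONALLY (`stub_thickLowerSetsChowRNoMD_of_largeDefect`).
Its members are the LARGE-DEFECT pairs (e.g. the order-3 starved pairs with `C(o,3) > (h·h − 3h)/3`, numerically easy). -/
def Stmt.stub_thickLowerSetsChowRLargeDefect : Prop :=
  ∃ h₀ : ℕ, ∀ h : ℕ, h₀ ≤ h → ∀ (r : ℕ) (v w' : Fin r → Finset (Fin h)),
    Function.Injective v → Function.Injective w' →
    IsLowerSet (Set.range v) → IsLowerSet (Set.range w') →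
    h * h < (∑ i, (v i).card) + 2 * h → h * h < (∑ j, (w' j).card) + 2 * h →
    ¬ IsXStarCertifiable v w' → ¬ IsXStarCertifiable w' v → ¬ IsBiStarCertifiable v w' →
    ¬ Summit.ValiantsHypothesis.ValiantsHypothesis.Theorems.BarrierLever.ChowStarvedDesign.IsStarvedPair v w' →
    ¬ Summit.ValiantsHypothesis.ValiantsHypothesis.Theorems.BarrierLever.ChowStarvedDesign.IsStarvedPair w' v →
    ¬ (Summit.ValiantsHypothesis.ValiantsHypothesis.Theorems.BarrierLever.ChowMD.IsMDCertifiable v w' ∧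
        h + Fintype.card (Summit.ValiantsHypothesis.ValiantsHypothesis.Theorems.BarrierLever.ChowMD.rowDefect v w') + 2 * h
          ≤ h * h) →
    h * h < h + Summit.ValiantsHypothesis.ValiantsHypothesis.Theorems.BarrierLever.ChowHybrid.colDefectMass v w' + 2 * h →
    h * h < h + Summit.ValiantsHypothesis.ValiantsHypothesis.Theorems.BarrierLever.ChowHybrid.colDefectMass w' v + 2 * h →
    ∃ m : ℕ, m + 2 * h ≤ h * h ∧ ∃ ℓ : Fin m → MvPolynomial (Fin (h + h)) ℂ,
      (∀ k, (ℓ k).totalDegree ≤ 1) ∧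
      (Matrix.of fun i j : Fin r => MvPolynomial.coeff
        (∑ a ∈ v i, Finsupp.single (Fin.castAdd h a) 1 +
          ∑ c ∈ w' j, Finsupp.single (Fin.natAdd h c) 1) (∏ k, ℓ k)).det ≠ 0

/-- **GLUE (unconditional, THEOREM H): the large-defect node implies the NoMD node** — a pair with a small defect mass on
either side is hit within budget by the hybrid design. -/
theorem stub_thickLowerSetsChowRNoMD_of_largeDefect (hN : Stmt.stub_thickLowerSetsChowRLargeDefect) :
    Stmt.stub_thickLowerSetsChowRNoMD := by
  obtain ⟨h₀, hN⟩ := hN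
  refine ⟨h₀, fun h hh r v w' hv hw hlv hlw hV hW hX hY hB hS hS' hMD => ?_⟩
  by_cases h1 : h + colDefectMass v w' + 2 * h ≤ h * h
  · exact exists_chow_of_small_defect v w' hv hw hlv hlw (Or.inl h1)
  by_cases h2 : h + colDefectMass w' v + 2 * h ≤ h * h
  · exact exists_chow_of_small_defect v w' hv hw hlv hlw (Or.inr h2)
  exact hN h hh r v w' hv hw hlv hlw hV hW hX hY hB hS hS' hMD (not_le.mp h1) (not_le.mp h2)

/-- **THE ITEM FROM THE LARGE-DEFECT NODE** (glue, then the NoMD composition of p729761). -/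
theorem chowHitsPartitionMinorsR_of_thickLowerSetsLargeDefect (hN : Stmt.stub_thickLowerSetsChowRLargeDefect) :
    Summit.ValiantsHypothesis.ValiantsHypothesis.Theses.BarrierLever.ChowHitsPartitionMinorsR :=
  chowHitsPartitionMinorsR_of_thickLowerSetsNoMD (stub_thickLowerSetsChowRNoMD_of_largeDefect hN)

/-- **Unconditional lower-set corollary, by name**: the v1b lower-set node restricted to SMALL-DEFECT pairs is a theorem —
every injective lower-set pair with `h + ‖C∖R‖ + 2h ≤ h·h` or `h + ‖R∖C‖ + 2h ≤ h·h` is hit within budget (no thickness,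
no star hypotheses needed). -/
theorem lowerSets_smallDefect_hit (h r : ℕ) (v w' : Fin r → Finset (Fin h))
    (hv : Function.Injective v) (hw : Function.Injective w')
    (hlv : IsLowerSet (Set.range v)) (hlw : IsLowerSet (Set.range w'))
    (hsmall : h + colDefectMass v w' + 2 * h ≤ h * h ∨ h + colDefectMass w' v + 2 * h ≤ h * h) :
    ∃ m : ℕ, m + 2 * h ≤ h * h ∧ ∃ ℓ : Fin m → MvPolynomial (Fin (h + h)) ℂ,
      (∀ k, (ℓ k).totalDegree ≤ 1) ∧
      (Matrix.of fun i j : Fin r => MvPolynomial.coeff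
        (∑ a ∈ v i, Finsupp.single (Fin.castAdd h a) 1 +
          ∑ c ∈ w' j, Finsupp.single (Fin.natAdd h c) 1) (∏ k, ℓ k)).det ≠ 0 :=
  exists_chow_of_small_defect v w' hv hw hlv hlw hsmall

end Summit.ValiantsHypothesis.ValiantsHypothesis.Theorems.BarrierLever.ChowNoStar

end
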